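import Literature.Computability.AlgebraicComplexity.CwCubeKoszulCertMain
import Literature.Computability.AlgebraicComplexity.BorderRankCWKoszulProofs
import HarnessLib

/-!
# CGLV 2022, Thm. 3.4, the literal rank statement `CGLV2022_thm34_koszulRank`: status and the case `q = 5`

Topic: `Literature/Computability/AlgebraicComplexity`.  Companion of `BorderRankCWKoszul.lean`, which
vendors the named fact `CGLV2022_thm34_koszulRank` (Conner–Gesmundo–Landsberg–Ventura, *Rank and
border rank of Kronecker powers of tensors and Strassen's laser method*, comput. complexity 31
(2022) = arXiv:1909.04785v2, proof of Thm. 3.4: "We will show `rank((T_q)^{∧2}_{A'}) = 6(q+2)³`",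
`T_q = φ₃(T_{cw,q}^{⊠3})`, for all `q ≥ 5`), written after the review of that fact as a
decomposition child of `CGLV2022_thm12_power` (2026-08-15).  Everything here is PROVED; there are no
definitions and no named facts.

## Status of the fact

* It is NO LONGER LOAD-BEARING.  Its parent and every statement of the source that consumed it are
  discharged unconditionally in the tree through the dead-label restriction
  `extendPhi 5 q (cglvPhi3 _ 5)` instead of the printed `φ₃ = cglvPhi3 _ q`:
  `CGLV2022_thm12_power_holds`, `CGLV2022_cor35_holds`, `CGLV2022_thm12_cube_holds`,
  `CGLV2022_thm12_holds` (`BorderRankCWThm12Cube.lean`, with `CwCubeDeadLabels.lean`,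
  `CwCubeKoszulCert*.lean`).  The conditional assemblies taking `(h34 : CGLV2022_thm34_koszulRank)`
  (`CGLV2022_thm12_power_of_koszulRank`, `CGLV2022_cor35_of_koszulRank`, `CGLV2022_thm12_of_thm34`, …)
  are superseded by these but kept.
* It remains a faithful transcription of a printed, computer-proved claim, hence a legitimate named
  fact; only the inequality `6(q+2)³ ≤ rank` carries content (`CGLV2022_thm34_koszulRank_iff_ge`).
* `CGLV2022_thm34_koszulRank_five` (below): the instance `q = 5` IS the kernel-certified rank
  `2058 = 6·7³` of `K₅ = K(φ₃|₅, T_{cw,5}^{⊠3})` (`K5.blockRank_E_ge` and `blockRank_none`: at `q = 5`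
  the dead-label restriction and `φ₃` coincide).  Hence the fact is equivalent to its part `q ≥ 6`
  (`CGLV2022_thm34_koszulRank_iff_six_le`).

## Why the literal statement for `q ≥ 6` is not a corollary of the dead-label bound, and how it reduces

For `q ≥ 6` the printed row `φ₃ᵀ(e¹) = ∑_{i=1}^{q} (α_{i00} + α_{0i0} + α_{00i})` does not kill the
labels `6, …, q`, so `K(φ₃, T_{cw,q}^{⊠3})` is not block diagonal by dead pattern.  It becomes so after
a symmetry of `T_{cw,q}` (this is the elementary content of the source's `𝔖_{q-4}^{×3}`-isotypic
decomposition, checked numerically in the review, not formalised):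

1. Put `m = q - 4`, `u = e₅ + ⋯ + e_q`, and let `N` be the (real) Householder reflection of
   `⟨e₅, …, e_q⟩` exchanging `u` and `√m·e₅` (`N = 1` if `q = 5`), extended by the identity on the
   labels `≤ 4`.  `N` is symmetric and complex-orthogonal, so `(N, N, N)·T_{cw,q} = T_{cw,q}`
   (`∑_j b_j ⊗ c_j` is `O(q)`-invariant).  By `GL(B) × GL(C)`-equivariance of Koszul flattenings
   and functoriality of `⊠`, `rank K(φ₃, T_{cw,q}^{⊠3}) = rank K(φ₃ ∘ N^{⊗3}, T_{cw,q}^{⊠3})`, and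
   `φ₃ ∘ N^{⊗3} = extendPhi 5 q (M_c)`, `c = √m`, where `M_c` is `φ₃|₅ = cglvPhi3 _ 5` with its three
   entries `(e¹; (5,0,0)), (e¹; (0,5,0)), (e¹; (0,0,5))` multiplied by `c` (rows `e⁰, e², e³, e⁴`
   live on the labels `≤ 4`; for `e¹` use `N(e₁ + ⋯ + e₄ + u) = e₁ + ⋯ + e₄ + √m·e₅`).
2. Hence, by `cube_blockRank_le_rank_koszulFlattening_extendPhi` (which holds for ANY alive
   restriction), `rank K(φ₃, T_{cw,q}^{⊠3}) ≥ ∑_{F ⊆ {0,1,2}} (q-5)^{|F|} · blockRank 2 M_{√m} F`.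
3. Conjugating by `diag(c^{#{slots with label 5}})` turns the frozen blocks of `K(M_c, T_{cw,5}^{⊠3})`
   into those of the INTEGER family `B(m) = K(φ₃|₅, T'(m)^{⊠3})`,
   `T'(m) = T_{cw,5} + (m-1)·a₅ ⊗ b₀ ⊗ c₅` (entries of `B(m)` affine in `m`; `m` enters only through
   the slice entry `b₀ ↦ c₅` of `a₅`), evaluated at `m = c² = q - 4`:
   `blockRank 2 M_{√m} F = rank B(m)[fix_F]`.  (`B(1) = K₅`.)

So the fact for all `q ≥ 5` is equivalent to: for every integer `m ≥ 1` the eight frozen blocks of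
`B(m)` have ranks `≥ 2058; 294, 294, 294; 42, 42, 42; 6` — CGLV's table, with `m` symbolic.

## What was computed in the review (exact arithmetic outside Lean; evidence, not proof)

* Literal ranks by sparse elimination of the `10(q+1)³`-square matrices: `2058, 3072, 4374 = 6(q+2)³`
  for `q = 5, 6, 7` (the vendor had checked `q = 5, 6`); the block formula of step 2–3 reproduces the
  literal rank exactly for `q = 5, 6, 7`, also for three perturbed restrictions with unsaturated ranks.
* Blocks of `B(m)`: ranks `2058; 294³; 42³; 6` for `m = 1, …, 6, 10` and for `m = -1, …, -6`; at
  `m = 0` the big block drops to `2002` (the others do not).  Consequently every `2058`-minor of the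
  big block has determinant divisible by `m`: the family CANNOT be certified by finitely many
  numeric (mod `p`) instances — a certificate must divide by `m` symbolically.
* Symbolic elimination of the big block over `ℤ[m]` (`2160 × 2160`, `10422` non-zero affine entries):
  `1967` pivots `±1` (Markowitz order, fraction-free, multipliers of degree `≤ 3`, `10835` of them),
  leaving `108 × 94` of degree `≤ 3`; then `31` constant pivots; `71` of the remaining `75` rows are
  divisible by `m` — divide; `45` constant pivots; `9` rows `÷ m`; `1` pivot; `1` row `÷ m`; the final
  `22 × 15` pencil `R₀ + m·R₁` contains a `14 × 14` minor with CONSTANT non-zero determinant.  Total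
  `1967 + 31 + 45 + 1 + 14 = 2058` for every `m ≠ 0` (every complex `m ≠ 0`, in fact).  The seven
  small blocks are eliminated completely by `±1` pivots (`650/566/650`, `41/48/48`, `0` multipliers).
  So CGLV's computation is confirmed for ALL `q ≥ 5`, independently of the source's matrices `P, Q`.

## The Lean route for the literal statement (size L; deliberately NOT carried out)

(L1) rank-equivariance of `koszulFlattening ∘ kroneckerPow` under `GL(A) × GL(B) × GL(C)` and
`(N,N,N)·T_{cw,q} = T_{cw,q}`; (L2) the identity `φ₃ ∘ N^{⊗3} = extendPhi 5 q M_{√(q-4)}` over `ℂ`;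
(L3) `blockRank 2 M_c F = rank B(c²)[fix_F]` by diagonal conjugation, `B(m)` over `ℤ` + base change;
(L4) a polynomial-entry variant of `PackedRowLUCertificate.lean` (entries of `L, U` in `ℤ[m]` as
coefficient lists, cf. `Literature.Algebra.Polynomial.CoeffList` in `CwSquareKoszulCert.lean`):
data `D·B_S = L·U` with `D` a diagonal of powers of `m`, `L` unit lower triangular, `U` upper
triangular with non-zero CONSTANT diagonal (plus one dense end-game block `≤ 108 × 94`), checked as an
identity in `ℤ[m]` by `decide`; soundness: `det B_S(m₀) ≠ 0` for every integer `m₀ ≥ 1`; expected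
size ≈ `14k + 17k` entries of degree `≤ 3` (≈ 1.5 × the numeric certificate `K5.certE`), kernel time a
small multiple of its ≈ 60 s, to be chunked the same way; (L5) the small blocks (`±1` pivots only);
(L6) assembly with `rank_koszulFlattening_cglvPhi3_le`.  No new named fact is needed anywhere; there
is no M-sized PUBLISHED sub-result to split into (the eight block ranks with `m` symbolic are not
printed statements), so the fact is not to be split again.

## References

* A. Conner, F. Gesmundo, J. M. Landsberg, E. Ventura, *Rank and border rank of Kronecker powers of
  tensors and Strassen's laser method*, comput. complexity 31 (2022) = arXiv:1909.04785v2, Thm. 3.4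
  and its proof (`φ₃`, the table `2058 / 294 / 42 / 6`, "entries depending linearly on `q`", the
  matrices `P, M, Q`), §3.3 (Schur's lemma), §6. [ConnerGesmundoLandsbergVentura2022]
-/

noncomputable section

namespace Literature.Computability.AlgebraicComplexity

/-- **CGLV 2022, Thm. 3.4 (proof), the rank at `q = 5` — PROVED**: the `p = 2` Koszul flattening of
`φ₃(T_{cw,5}^{⊠3})` has rank exactly `6 · 7³ = 2058` (the printed `φ₃`, not only its dead-label
extension: at `q = 5` they coincide).  Lower bound: the kernel-checked certificate `K5.blockRank_E_ge`
(`CwCubeKoszulCertMain.lean`) read through `blockRank_none`; upper bound: the Koszul bound and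
`bR(T_{cw,5}^{⊠3}) ≤ 7³` (`rank_koszulFlattening_cglvPhi3_le`).
[cite: ConnerGesmundoLandsbergVentura2022, Thm. 3.4 (proof)] -/
theorem CGLV2022_thm34_koszulRank_five :
    (koszulFlattening 2 (cglvPhi3 ℂ 5).mulVecLin (kroneckerPow (cwTensor ℂ 5) 3)).rank =
      6 * (5 + 2) ^ 3 := by
  refine le_antisymm (rank_koszulFlattening_cglvPhi3_le 5) ?_
  have h := K5.blockRank_E_ge
  have e : (![false, false, false] : Fin 3 → Bool) = fun _ => false := by
    funext i
    fin_cases i <;> rfl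
  rw [e, blockRank_none] at h
  norm_num
  exact h

/-- The lower-bound form at `q = 5`: `6 · 7³ ≤ rank`. [cite: ConnerGesmundoLandsbergVentura2022, Thm. 3.4 (proof)] -/
theorem CGLV2022_thm34_koszulRank_five_ge :
    6 * (5 + 2) ^ 3 ≤
      (koszulFlattening 2 (cglvPhi3 ℂ 5).mulVecLin (kroneckerPow (cwTensor ℂ 5) 3)).rank :=
  CGLV2022_thm34_koszulRank_five.ge

/-- **What is left of the fact**: `CGLV2022_thm34_koszulRank` is equivalent to the lower bounds
`6(q+2)³ ≤ rank((φ₃ T_{cw,q}^{⊠3})^{∧2}_{A'})` for `q ≥ 6` alone (the case `q = 5` being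
`CGLV2022_thm34_koszulRank_five`, the upper bounds being free, `CGLV2022_thm34_koszulRank_iff_ge`).
[cite: ConnerGesmundoLandsbergVentura2022, Thm. 3.4 (proof)] -/
theorem CGLV2022_thm34_koszulRank_iff_six_le :
    CGLV2022_thm34_koszulRank ↔ ∀ q : ℕ, 6 ≤ q →
      6 * (q + 2) ^ 3 ≤
        (koszulFlattening 2 (cglvPhi3 ℂ q).mulVecLin (kroneckerPow (cwTensor ℂ q) 3)).rank := by
  rw [CGLV2022_thm34_koszulRank_iff_ge]
  refine ⟨fun h q hq => h q (by omega), fun h q hq => ?_⟩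
  rcases Nat.lt_or_ge q 6 with h5 | h6
  · obtain rfl : q = 5 := by omega
    exact CGLV2022_thm34_koszulRank_five_ge
  · exact h q h6

end Literature.Computability.AlgebraicComplexity

end
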